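import Summits.RiemannHypothesis.RiemannHypothesis.Theorems.WeilFormatCZetaTailGram
import Summits.RiemannHypothesis.RiemannHypothesis.Theorems.WeilFormatCTrigTailSums
import HarnessLib

/-!
# Format C, L-C3b mean-square tail: the generic algebra (`F² = G² + 2GS + S²`, guarded resonances, Gram assembly)

Route context: Fourier–Galerkin / Schur-complement certificates of Weil positivity on a window ("format C";
cell memo `run/shared/lean/pub/rh-explicit/rh-explicit-weil-10/FORMATC-DESIGN.md` §9.9.3 (ii); supporting
stmt-RiemannHypothesis-0098; seat rh-explicit-weil-10; lead ruling R7-43 (2)).  The mode function of the order-`J`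
tail is `F = A + S − T` with a smooth part `A − T` (`|A − T − π/4| ≤ c`) and a prime sum `S = Σ_{k∈P} w_k sin(xθ_k)`
(`w_k ≥ 0`).  This file is pure algebra/trigonometry over an arbitrary finite index set `P`:

* `modeSq_le` — `F² ≤ c̄ + osc(x)` with `c̄ = (π/4 + c)² + ½Σw² + 2cΣw + κ` and an OSCILLATORY part
  `osc(x) = (π/2)Σ_k χ₁(k)w_k sin(xθ_k) + ½Σ_{k≠k'} χ₋ w_kw_{k'} cos(x(θ_k−θ_{k'})) − ½Σ_{k,k'} χ₊ w_kw_{k'} cos(x(θ_k+θ_{k'}))`,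
  where the data `s₁, s₋, s₊` switch each frequency between "guarded" (`χ = 1`, `s ≠ 0`) and "crude" (`s = 0`: the
  weight joins `κ`);
* `abs_guard_mul_sum_Ico_trig_le` — one guarded frequency against `1/m^E`: `≤ (w/s)/B₃^E` (Abel; `w/0 = 0`);
* `abs_sum_Ico_osc_div_pow_le` — `|Σ_{m∈Ico B₃ N} osc(m)/m^E| ≤ R/B₃^E`,
  `R = (π/2)Σ_k w_k/s₁(k) + ½Σ_{k≠k'} w_kw_{k'}/s₋(k,k') + ½Σ_{k,k'} w_kw_{k'}/s₊(k,k')`, given `0 ≤ s ≤ |sin(φ/2)|`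
  wherever the weight is non-zero;
* `sum_sq_mul_sq_le_of_mode_bounds` — assembly: `Σ_m F_m²P(m)² ≤ c̄·Q + Σ_j α_j²Σ_{j'} ρ_{jj'}λ_{j'}/λ_j` from a per-mode
  bound, a bound `Q` for `Σ_m P(m)²` and entrywise bounds `ρ` for the oscillatory Gram (`gram_le_mid_add_gershgorin`).

Standard axioms; no definitions; no RH claim.
-/

set_option autoImplicit false
-- `Summit.RiemannHypothesis.RiemannHypothesis.…` is the layout-mandated namespace (summit = problem name).
set_option linter.dupNamespace false

noncomputable section

open Finset
open scoped Real BigOperators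

namespace Summit.RiemannHypothesis.RiemannHypothesis.Theorems.WeilFormatC

/-! ## Trigonometric identities for the square of the prime sum -/

section Trig

/-- Product-to-sum: `sin A sin B = (cos(A−B) − cos(A+B))/2`. -/
theorem sin_mul_sin_eq (A B : ℝ) : Real.sin A * Real.sin B = (Real.cos (A - B) - Real.cos (A + B)) / 2 := by
  rw [Real.cos_sub, Real.cos_add]; ring

/-- The square of a sine sum as a double cosine sum:
`(Σ_k w_k sin(xθ_k))² = ½Σ_kΣ_{k'} w_kw_{k'}cos(x(θ_k−θ_{k'})) − ½Σ_kΣ_{k'} w_kw_{k'}cos(x(θ_k+θ_{k'}))`. -/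
theorem sq_sum_sin_eq (P : Finset ℕ) (w θ : ℕ → ℝ) (x : ℝ) :
    (∑ k ∈ P, w k * Real.sin (x * θ k)) ^ 2
      = (∑ k ∈ P, ∑ k' ∈ P, w k * w k' * Real.cos (x * (θ k - θ k'))) / 2
        - (∑ k ∈ P, ∑ k' ∈ P, w k * w k' * Real.cos (x * (θ k + θ k'))) / 2 := by
  rw [sq, Finset.sum_mul_sum, ← sub_div, ← Finset.sum_sub_distrib, Finset.sum_div]
  refine Finset.sum_congr rfl fun k _ ↦ ?_
  rw [← Finset.sum_sub_distrib, Finset.sum_div]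
  refine Finset.sum_congr rfl fun k' _ ↦ ?_
  rw [mul_sub, mul_add, show w k * Real.sin (x * θ k) * (w k' * Real.sin (x * θ k'))
    = w k * w k' * (Real.sin (x * θ k) * Real.sin (x * θ k')) by ring, sin_mul_sin_eq]
  ring

/-- Splitting the diagonal off a double sum over a finset: `Σ_kΣ_{k'} f = Σ_k f(k,k) + Σ_k Σ_{k'≠k} f`. -/
theorem sum_sum_eq_diag_add_offDiag (P : Finset ℕ) (f : ℕ → ℕ → ℝ) :
    ∑ k ∈ P, ∑ k' ∈ P, f k k' = ∑ k ∈ P, f k k + ∑ k ∈ P, ∑ k' ∈ P.erase k, f k k' := by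
  rw [← Finset.sum_add_distrib]
  refine Finset.sum_congr rfl fun k hk ↦ ?_
  rw [← Finset.add_sum_erase P _ hk]

end Trig

/-! ## The per-mode mean-square split -/

section Mode

/-- **Per-mode mean-square split.**  For `F = A + S − T`, `|A − T − π/4| ≤ c`, `S = Σ_{k∈P} w_k sin(xθ_k)`, `w ≥ 0`,
and ANY data `s₁, s₋, s₊` (value `0` = crude frequency):
`F² ≤ [(π/4 + c)² + ½Σw² + 2cΣw + κ] + osc(x)` (see the module docstring for `κ` and `osc`). -/
theorem modeSq_le (P : Finset ℕ) (w θ : ℕ → ℝ) (hw : ∀ k, 0 ≤ w k) (x A T : ℝ) {c : ℝ} (hc : 0 ≤ c)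
    (hG : |A - T - π / 4| ≤ c) (s₁ : ℕ → ℝ) (sm sp : ℕ → ℕ → ℝ) :
    (A + (∑ k ∈ P, w k * Real.sin (x * θ k)) - T) ^ 2
      ≤ ((π / 4 + c) ^ 2 + (∑ k ∈ P, w k ^ 2) / 2 + 2 * c * (∑ k ∈ P, w k)
          + ((π / 2) * (∑ k ∈ P, if s₁ k = 0 then w k else 0)
            + (∑ k ∈ P, ∑ k' ∈ P.erase k, if sm k k' = 0 then w k * w k' else 0) / 2
            + (∑ k ∈ P, ∑ k' ∈ P, if sp k k' = 0 then w k * w k' else 0) / 2))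
        + ((π / 2) * (∑ k ∈ P, (if s₁ k = 0 then (0 : ℝ) else 1) * w k * Real.sin (x * θ k))
          + (∑ k ∈ P, ∑ k' ∈ P.erase k,
              (if sm k k' = 0 then (0 : ℝ) else 1) * (w k * w k') * Real.cos (x * (θ k - θ k'))) / 2
          - (∑ k ∈ P, ∑ k' ∈ P,
              (if sp k k' = 0 then (0 : ℝ) else 1) * (w k * w k') * Real.cos (x * (θ k + θ k'))) / 2) := by
  set S := ∑ k ∈ P, w k * Real.sin (x * θ k) with hS
  set W1 := ∑ k ∈ P, w k with hW1
  set W2 := ∑ k ∈ P, w k ^ 2 with hW2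
  -- |S| ≤ W1
  have hSm : |S| ≤ W1 := by
    rw [hS, hW1]
    refine (Finset.abs_sum_le_sum_abs _ _).trans (Finset.sum_le_sum fun k _ ↦ ?_)
    rw [abs_mul, abs_of_nonneg (hw k)]
    exact (mul_le_mul_of_nonneg_left (Real.abs_sin_le_one _) (hw k)).trans (le_of_eq (mul_one _))
  -- S² = W2/2 + (double cosine sums)
  have hS2 : S ^ 2 = W2 / 2 + ((∑ k ∈ P, ∑ k' ∈ P.erase k, w k * w k' * Real.cos (x * (θ k - θ k'))) / 2
      - (∑ k ∈ P, ∑ k' ∈ P, w k * w k' * Real.cos (x * (θ k + θ k'))) / 2) := by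
    rw [hS, hW2, sq_sum_sin_eq, sum_sum_eq_diag_add_offDiag P (fun k k' ↦ w k * w k' * Real.cos (x * (θ k - θ k')))]
    have hdiag : ∑ k ∈ P, w k * w k * Real.cos (x * (θ k - θ k)) = ∑ k ∈ P, w k ^ 2 :=
      Finset.sum_congr rfl fun k _ ↦ by rw [sub_self, mul_zero, Real.cos_zero, mul_one, sq]
    rw [hdiag]
    ring
  -- the smooth part
  have hG2 : (A - T) ^ 2 ≤ (π / 4 + c) ^ 2 := by
    have h1 : |A - T| ≤ π / 4 + c := by
      have := abs_sub_abs_le_abs_sub (A - T) (π / 4)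
      rw [abs_of_pos (by positivity : (0 : ℝ) < π / 4)] at this
      linarith
    calc (A - T) ^ 2 = |A - T| ^ 2 := (sq_abs _).symm
      _ ≤ (π / 4 + c) ^ 2 := pow_le_pow_left₀ (abs_nonneg _) h1 2
  have hGS : 2 * (A - T) * S ≤ (π / 2) * S + 2 * c * W1 := by
    have e1 : 2 * (A - T) * S = (π / 2) * S + 2 * (A - T - π / 4) * S := by ring
    rw [e1]
    have h2 : |2 * (A - T - π / 4) * S| ≤ 2 * c * W1 := by
      rw [abs_mul, abs_mul, abs_of_pos (by norm_num : (0 : ℝ) < 2)]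
      exact mul_le_mul (mul_le_mul_of_nonneg_left hG (by norm_num)) hSm (abs_nonneg _)
        (mul_nonneg (by norm_num) hc)
    linarith [(abs_le.mp h2).2]
  -- guarded / crude split of every frequency
  have hsplit : (π / 2) * S
      + ((∑ k ∈ P, ∑ k' ∈ P.erase k, w k * w k' * Real.cos (x * (θ k - θ k'))) / 2
        - (∑ k ∈ P, ∑ k' ∈ P, w k * w k' * Real.cos (x * (θ k + θ k'))) / 2)
      ≤ ((π / 2) * (∑ k ∈ P, if s₁ k = 0 then w k else 0)
            + (∑ k ∈ P, ∑ k' ∈ P.erase k, if sm k k' = 0 then w k * w k' else 0) / 2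
            + (∑ k ∈ P, ∑ k' ∈ P, if sp k k' = 0 then w k * w k' else 0) / 2)
        + ((π / 2) * (∑ k ∈ P, (if s₁ k = 0 then (0 : ℝ) else 1) * w k * Real.sin (x * θ k))
          + (∑ k ∈ P, ∑ k' ∈ P.erase k,
              (if sm k k' = 0 then (0 : ℝ) else 1) * (w k * w k') * Real.cos (x * (θ k - θ k'))) / 2
          - (∑ k ∈ P, ∑ k' ∈ P,
              (if sp k k' = 0 then (0 : ℝ) else 1) * (w k * w k') * Real.cos (x * (θ k + θ k'))) / 2) := by
    have e1 : ∀ k, w k * Real.sin (x * θ k)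
        ≤ (if s₁ k = 0 then (0 : ℝ) else 1) * w k * Real.sin (x * θ k) + (if s₁ k = 0 then w k else 0) := by
      intro k
      split_ifs
      · have := mul_le_mul_of_nonneg_left (Real.sin_le_one (x * θ k)) (hw k); linarith
      · linarith
    have e2 : ∀ k k', w k * w k' * Real.cos (x * (θ k - θ k'))
        ≤ (if sm k k' = 0 then (0 : ℝ) else 1) * (w k * w k') * Real.cos (x * (θ k - θ k'))
          + (if sm k k' = 0 then w k * w k' else 0) := by
      intro k k'
      split_ifs
      · have := mul_le_mul_of_nonneg_left (Real.cos_le_one (x * (θ k - θ k'))) (mul_nonneg (hw k) (hw k'))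
        linarith
      · linarith
    have e3 : ∀ k k', -(w k * w k' * Real.cos (x * (θ k + θ k')))
        ≤ -((if sp k k' = 0 then (0 : ℝ) else 1) * (w k * w k') * Real.cos (x * (θ k + θ k')))
          + (if sp k k' = 0 then w k * w k' else 0) := by
      intro k k'
      split_ifs
      · have := mul_le_mul_of_nonneg_left (Real.neg_one_le_cos (x * (θ k + θ k'))) (mul_nonneg (hw k) (hw k'))
        linarith
      · linarith
    have f1 : S ≤ (∑ k ∈ P, (if s₁ k = 0 then (0 : ℝ) else 1) * w k * Real.sin (x * θ k))
        + ∑ k ∈ P, (if s₁ k = 0 then w k else 0) := by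
      rw [hS, ← Finset.sum_add_distrib]; exact Finset.sum_le_sum fun k _ ↦ e1 k
    have f2 : (∑ k ∈ P, ∑ k' ∈ P.erase k, w k * w k' * Real.cos (x * (θ k - θ k')))
        ≤ (∑ k ∈ P, ∑ k' ∈ P.erase k,
            (if sm k k' = 0 then (0 : ℝ) else 1) * (w k * w k') * Real.cos (x * (θ k - θ k')))
          + ∑ k ∈ P, ∑ k' ∈ P.erase k, (if sm k k' = 0 then w k * w k' else 0) := by
      rw [← Finset.sum_add_distrib]
      refine Finset.sum_le_sum fun k _ ↦ ?_
      rw [← Finset.sum_add_distrib]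
      exact Finset.sum_le_sum fun k' _ ↦ e2 k k'
    have f3 : -(∑ k ∈ P, ∑ k' ∈ P, w k * w k' * Real.cos (x * (θ k + θ k')))
        ≤ -(∑ k ∈ P, ∑ k' ∈ P, (if sp k k' = 0 then (0 : ℝ) else 1) * (w k * w k') * Real.cos (x * (θ k + θ k')))
          + ∑ k ∈ P, ∑ k' ∈ P, (if sp k k' = 0 then w k * w k' else 0) := by
      rw [← Finset.sum_neg_distrib, ← Finset.sum_neg_distrib, ← Finset.sum_add_distrib]
      refine Finset.sum_le_sum fun k _ ↦ ?_
      rw [← Finset.sum_neg_distrib, ← Finset.sum_neg_distrib, ← Finset.sum_add_distrib]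
      exact Finset.sum_le_sum fun k' _ ↦ e3 k k'
    have f1' := mul_le_mul_of_nonneg_left f1 (le_of_lt (by positivity : (0 : ℝ) < π / 2))
    linarith [f1', f2, f3]
  have e2 : (A + S - T) ^ 2 = (A - T) ^ 2 + 2 * (A - T) * S + S ^ 2 := by ring
  rw [e2, hS2]
  linarith [hG2, hGS, hsplit]

end Mode

/-! ## The oscillatory Gram: Abel bounds with guarded resonances -/

section Osc

/-- One guarded frequency against the inverse powers: for `c ≥ 0` and either `c = 0` or `0 ≤ s ≤ |sin(φ/2)|`,
`|χ·c·Σ_{m∈Ico B₃ N} cos(mφ)/m^E| ≤ (c/s)/B₃^E` with `χ = [s ≠ 0]` (and the same for `sin`; `c/0 = 0`). -/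
theorem abs_guard_mul_sum_Ico_trig_le {s φ c : ℝ} (hc : 0 ≤ c) (hs : c = 0 ∨ (0 ≤ s ∧ s ≤ |Real.sin (φ / 2)|))
    {B₃ : ℕ} (hB₃ : 1 ≤ B₃) (E N : ℕ) :
    |(if s = 0 then (0 : ℝ) else 1) * c * ∑ m ∈ Finset.Ico B₃ N, 1 / (m : ℝ) ^ E * Real.cos (m * φ)|
        ≤ c / s * (1 / (B₃ : ℝ) ^ E) ∧
      |(if s = 0 then (0 : ℝ) else 1) * c * ∑ m ∈ Finset.Ico B₃ N, 1 / (m : ℝ) ^ E * Real.sin (m * φ)|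
        ≤ c / s * (1 / (B₃ : ℝ) ^ E) := by
  by_cases hz : s = 0
  · simp only [hz, if_true, zero_mul, abs_zero, div_zero]; exact ⟨le_rfl, le_rfl⟩
  rcases hs with h0 | hs
  · simp only [h0, mul_zero, zero_mul, abs_zero, zero_div]; exact ⟨le_rfl, le_rfl⟩
  have hs0 : 0 < s := hs.1.lt_of_ne (Ne.symm hz)
  have hφ : Real.sin (φ / 2) ≠ 0 := fun h ↦ by
    have := lt_of_lt_of_le hs0 hs.2
    rw [h, abs_zero] at this
    exact lt_irrefl _ this
  have hA := abs_sum_Ico_cos_div_pow_le hφ hB₃ E N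
  have hb : 1 / (B₃ : ℝ) ^ E / |Real.sin (φ / 2)| ≤ 1 / (B₃ : ℝ) ^ E / s :=
    div_le_div_of_nonneg_left (by positivity) hs0 hs.2
  simp only [hz, if_false, one_mul]
  constructor
  · rw [abs_mul, abs_of_nonneg hc]
    calc c * _ ≤ c * (1 / (B₃ : ℝ) ^ E / s) := mul_le_mul_of_nonneg_left (hA.1.trans hb) hc
      _ = c / s * (1 / (B₃ : ℝ) ^ E) := by ring
  · rw [abs_mul, abs_of_nonneg hc]
    calc c * _ ≤ c * (1 / (B₃ : ℝ) ^ E / s) := mul_le_mul_of_nonneg_left (hA.2.trans hb) hc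
      _ = c / s * (1 / (B₃ : ℝ) ^ E) := by ring

/-- **The oscillatory Gram entry.**  With `osc` as in `modeSq_le` and data `0 ≤ s ≤ |sin(φ/2)|` at every frequency of
non-zero weight: `|Σ_{m∈Ico B₃ N} osc(m)/m^E| ≤ R/B₃^E`,
`R = (π/2)Σ_k w_k/s₁(k) + ½Σ_{k}Σ_{k'≠k} w_kw_{k'}/s₋(k,k') + ½Σ_{k,k'} w_kw_{k'}/s₊(k,k')`. -/
theorem abs_sum_Ico_osc_div_pow_le (P : Finset ℕ) (w θ : ℕ → ℝ) (hw : ∀ k, 0 ≤ w k)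
    (s₁ : ℕ → ℝ) (sm sp : ℕ → ℕ → ℝ)
    (hs₁ : ∀ k ∈ P, w k = 0 ∨ (0 ≤ s₁ k ∧ s₁ k ≤ |Real.sin (θ k / 2)|))
    (hsm : ∀ k ∈ P, ∀ k' ∈ P, k ≠ k' → w k * w k' = 0 ∨ (0 ≤ sm k k' ∧ sm k k' ≤ |Real.sin ((θ k - θ k') / 2)|))
    (hsp : ∀ k ∈ P, ∀ k' ∈ P, w k * w k' = 0 ∨ (0 ≤ sp k k' ∧ sp k k' ≤ |Real.sin ((θ k + θ k') / 2)|))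
    {B₃ : ℕ} (hB₃ : 1 ≤ B₃) (E N : ℕ) :
    |∑ m ∈ Finset.Ico B₃ N,
        ((π / 2) * (∑ k ∈ P, (if s₁ k = 0 then (0 : ℝ) else 1) * w k * Real.sin ((m : ℝ) * θ k))
          + (∑ k ∈ P, ∑ k' ∈ P.erase k,
              (if sm k k' = 0 then (0 : ℝ) else 1) * (w k * w k') * Real.cos ((m : ℝ) * (θ k - θ k'))) / 2
          - (∑ k ∈ P, ∑ k' ∈ P,
              (if sp k k' = 0 then (0 : ℝ) else 1) * (w k * w k') * Real.cos ((m : ℝ) * (θ k + θ k'))) / 2)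
        * (1 / (m : ℝ) ^ E)|
      ≤ ((π / 2) * (∑ k ∈ P, w k / s₁ k) + (∑ k ∈ P, ∑ k' ∈ P.erase k, w k * w k' / sm k k') / 2
          + (∑ k ∈ P, ∑ k' ∈ P, w k * w k' / sp k k') / 2) / (B₃ : ℝ) ^ E := by
  set T := Finset.Ico B₃ N with hT
  set g : ℕ → ℝ := fun m ↦ 1 / (m : ℝ) ^ E with hg
  set w₁ : ℕ → ℝ := fun k ↦ (if s₁ k = 0 then (0 : ℝ) else 1) * w k with hw₁
  set wm : ℕ → ℕ → ℝ := fun k k' ↦ (if sm k k' = 0 then (0 : ℝ) else 1) * (w k * w k') with hwm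
  set wp : ℕ → ℕ → ℝ := fun k k' ↦ (if sp k k' = 0 then (0 : ℝ) else 1) * (w k * w k') with hwp
  -- the three families after exchanging the order of summation
  have h1 : ∑ m ∈ T, (∑ k ∈ P, (if s₁ k = 0 then (0 : ℝ) else 1) * w k * Real.sin ((m : ℝ) * θ k)) * g m
      = ∑ k ∈ P, w₁ k * ∑ m ∈ T, g m * Real.sin ((m : ℝ) * θ k) := by
    simp only [hw₁, Finset.sum_mul, Finset.mul_sum]
    rw [Finset.sum_comm]
    exact Finset.sum_congr rfl fun k _ ↦ Finset.sum_congr rfl fun m _ ↦ by ring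
  have h2 : ∑ m ∈ T, (∑ k ∈ P, ∑ k' ∈ P.erase k,
        (if sm k k' = 0 then (0 : ℝ) else 1) * (w k * w k') * Real.cos ((m : ℝ) * (θ k - θ k'))) * g m
      = ∑ k ∈ P, ∑ k' ∈ P.erase k, wm k k' * ∑ m ∈ T, g m * Real.cos ((m : ℝ) * (θ k - θ k')) := by
    simp only [hwm, Finset.sum_mul, Finset.mul_sum]
    rw [Finset.sum_comm]
    refine Finset.sum_congr rfl fun k _ ↦ ?_
    rw [Finset.sum_comm]
    exact Finset.sum_congr rfl fun k' _ ↦ Finset.sum_congr rfl fun m _ ↦ by ring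
  have h3 : ∑ m ∈ T, (∑ k ∈ P, ∑ k' ∈ P,
        (if sp k k' = 0 then (0 : ℝ) else 1) * (w k * w k') * Real.cos ((m : ℝ) * (θ k + θ k'))) * g m
      = ∑ k ∈ P, ∑ k' ∈ P, wp k k' * ∑ m ∈ T, g m * Real.cos ((m : ℝ) * (θ k + θ k')) := by
    simp only [hwp, Finset.sum_mul, Finset.mul_sum]
    rw [Finset.sum_comm]
    refine Finset.sum_congr rfl fun k _ ↦ ?_
    rw [Finset.sum_comm]
    exact Finset.sum_congr rfl fun k' _ ↦ Finset.sum_congr rfl fun m _ ↦ by ring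
  have hexp : ∑ m ∈ T,
      ((π / 2) * (∑ k ∈ P, (if s₁ k = 0 then (0 : ℝ) else 1) * w k * Real.sin ((m : ℝ) * θ k))
        + (∑ k ∈ P, ∑ k' ∈ P.erase k,
            (if sm k k' = 0 then (0 : ℝ) else 1) * (w k * w k') * Real.cos ((m : ℝ) * (θ k - θ k'))) / 2
        - (∑ k ∈ P, ∑ k' ∈ P,
            (if sp k k' = 0 then (0 : ℝ) else 1) * (w k * w k') * Real.cos ((m : ℝ) * (θ k + θ k'))) / 2) * g m
      = (π / 2) * (∑ k ∈ P, w₁ k * ∑ m ∈ T, g m * Real.sin ((m : ℝ) * θ k))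
        + (∑ k ∈ P, ∑ k' ∈ P.erase k, wm k k' * ∑ m ∈ T, g m * Real.cos ((m : ℝ) * (θ k - θ k'))) / 2
        - (∑ k ∈ P, ∑ k' ∈ P, wp k k' * ∑ m ∈ T, g m * Real.cos ((m : ℝ) * (θ k + θ k'))) / 2 := by
    rw [← h1, ← h2, ← h3, Finset.mul_sum, Finset.sum_div, Finset.sum_div, ← Finset.sum_add_distrib,
      ← Finset.sum_sub_distrib]
    exact Finset.sum_congr rfl fun m _ ↦ by ring
  rw [hexp]
  -- bound each family
  have b1 : |(π / 2) * (∑ k ∈ P, w₁ k * ∑ m ∈ T, g m * Real.sin ((m : ℝ) * θ k))|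
      ≤ (π / 2) * (∑ k ∈ P, w k / s₁ k) * (1 / (B₃ : ℝ) ^ E) := by
    rw [abs_mul, abs_of_pos (by positivity : (0 : ℝ) < π / 2), mul_assoc]
    refine mul_le_mul_of_nonneg_left ?_ (by positivity)
    rw [Finset.sum_mul]
    refine (Finset.abs_sum_le_sum_abs _ _).trans (Finset.sum_le_sum fun k hk ↦ ?_)
    have h := (abs_guard_mul_sum_Ico_trig_le (hw k) (hs₁ k hk) hB₃ E N).2
    simpa only [hw₁, hg, hT, mul_assoc] using h
  have b2 : |(∑ k ∈ P, ∑ k' ∈ P.erase k, wm k k' * ∑ m ∈ T, g m * Real.cos ((m : ℝ) * (θ k - θ k'))) / 2|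
      ≤ (∑ k ∈ P, ∑ k' ∈ P.erase k, w k * w k' / sm k k') / 2 * (1 / (B₃ : ℝ) ^ E) := by
    rw [abs_div, abs_of_pos (by norm_num : (0 : ℝ) < 2), div_mul_eq_mul_div, Finset.sum_mul]
    refine div_le_div_of_nonneg_right ((Finset.abs_sum_le_sum_abs _ _).trans
      (Finset.sum_le_sum fun k hk ↦ ?_)) (by norm_num)
    rw [Finset.sum_mul]
    refine (Finset.abs_sum_le_sum_abs _ _).trans (Finset.sum_le_sum fun k' hk' ↦ ?_)
    have hk'P : k' ∈ P := Finset.mem_of_mem_erase hk'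
    have hne : k ≠ k' := (Finset.ne_of_mem_erase hk').symm
    have h := (abs_guard_mul_sum_Ico_trig_le (φ := θ k - θ k') (mul_nonneg (hw k) (hw k'))
      (hsm k hk k' hk'P hne) hB₃ E N).1
    simpa only [hwm, hg, hT, mul_assoc] using h
  have b3 : |(∑ k ∈ P, ∑ k' ∈ P, wp k k' * ∑ m ∈ T, g m * Real.cos ((m : ℝ) * (θ k + θ k'))) / 2|
      ≤ (∑ k ∈ P, ∑ k' ∈ P, w k * w k' / sp k k') / 2 * (1 / (B₃ : ℝ) ^ E) := by
    rw [abs_div, abs_of_pos (by norm_num : (0 : ℝ) < 2), div_mul_eq_mul_div, Finset.sum_mul]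
    refine div_le_div_of_nonneg_right ((Finset.abs_sum_le_sum_abs _ _).trans
      (Finset.sum_le_sum fun k hk ↦ ?_)) (by norm_num)
    rw [Finset.sum_mul]
    refine (Finset.abs_sum_le_sum_abs _ _).trans (Finset.sum_le_sum fun k' hk' ↦ ?_)
    have h := (abs_guard_mul_sum_Ico_trig_le (φ := θ k + θ k') (mul_nonneg (hw k) (hw k'))
      (hsp k hk k' hk') hB₃ E N).1
    simpa only [hwp, hg, hT, mul_assoc] using h
  calc _ ≤ |(π / 2) * (∑ k ∈ P, w₁ k * ∑ m ∈ T, g m * Real.sin ((m : ℝ) * θ k))|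
        + |(∑ k ∈ P, ∑ k' ∈ P.erase k, wm k k' * ∑ m ∈ T, g m * Real.cos ((m : ℝ) * (θ k - θ k'))) / 2|
        + |(∑ k ∈ P, ∑ k' ∈ P, wp k k' * ∑ m ∈ T, g m * Real.cos ((m : ℝ) * (θ k + θ k'))) / 2| :=
          (abs_sub _ _).trans (add_le_add (abs_add_le _ _) le_rfl)
    _ ≤ _ := add_le_add (add_le_add b1 b2) b3
    _ = _ := by ring

end Osc

/-! ## Assembly -/

section Assembly

/-- **Assembly of the mean-square Gram bound.**  From a per-mode bound `F_m² ≤ c̄ + osc_m` (`c̄ ≥ 0`), a bound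
`Σ_m P(m)² ≤ Q` for `P(m) = Σ_j α_j/m^{e_j}`, entrywise bounds `|Σ_m osc_m/m^{e_j+e_{j'}}| ≤ ρ_{jj'}` (symmetric) and
weights `λ > 0`: `Σ_m F_m²P(m)² ≤ c̄·Q + Σ_j α_j²Σ_{j'} ρ_{jj'}λ_{j'}/λ_j`. -/
theorem sum_sq_mul_sq_le_of_mode_bounds (T : Finset ℕ) (F osc : ℕ → ℝ) {cbar : ℝ} (hcbar : 0 ≤ cbar)
    {D : ℕ} (e : Fin D → ℕ) (α : Fin D → ℝ) (lam : Fin D → ℝ) (hlam : ∀ j, 0 < lam j)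
    (hmode : ∀ m ∈ T, F m ^ 2 ≤ cbar + osc m) {Q : ℝ} (hQ : ∑ m ∈ T, (∑ j, α j / (m : ℝ) ^ e j) ^ 2 ≤ Q)
    (ρ : Fin D → Fin D → ℝ) (hρ : ∀ j j', |∑ m ∈ T, osc m * (1 / (m : ℝ) ^ (e j + e j'))| ≤ ρ j j')
    (hρsymm : ∀ j j', ρ j j' = ρ j' j) :
    ∑ m ∈ T, F m ^ 2 * (∑ j, α j / (m : ℝ) ^ e j) ^ 2
      ≤ cbar * Q + ∑ j, α j ^ 2 * ∑ j', ρ j j' * lam j' / lam j := by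
  set Pα : ℕ → ℝ := fun m ↦ ∑ j, α j / (m : ℝ) ^ e j with hPα
  have hterm : ∀ m ∈ T, F m ^ 2 * Pα m ^ 2 ≤ cbar * Pα m ^ 2 + osc m * Pα m ^ 2 := by
    intro m hm
    have h := mul_le_mul_of_nonneg_right (hmode m hm) (sq_nonneg (Pα m))
    linarith
  set X : Fin D → Fin D → ℝ := fun j j' ↦ ∑ m ∈ T, osc m * (1 / (m : ℝ) ^ (e j + e j')) with hX
  have hoscsum : ∑ m ∈ T, osc m * Pα m ^ 2 = ∑ j, ∑ j', α j * α j' * X j j' := by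
    have hexp : ∀ m ∈ T, osc m * Pα m ^ 2 = ∑ j, ∑ j', α j * α j' * (osc m * (1 / (m : ℝ) ^ (e j + e j'))) := by
      intro m _
      simp only [hPα]
      rw [sq, Finset.sum_mul_sum, Finset.mul_sum]
      refine Finset.sum_congr rfl fun j _ ↦ ?_
      rw [Finset.mul_sum]
      refine Finset.sum_congr rfl fun j' _ ↦ ?_
      rw [pow_add]
      ring
    rw [Finset.sum_congr rfl hexp, Finset.sum_comm]
    refine Finset.sum_congr rfl fun j _ ↦ ?_
    rw [Finset.sum_comm]
    refine Finset.sum_congr rfl fun j' _ ↦ ?_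
    rw [hX, Finset.mul_sum]
  have hXle : ∀ j j', |X j j' - 0| ≤ ρ j j' := fun j j' ↦ by rw [sub_zero]; exact hρ j j'
  have hgersh := gram_le_mid_add_gershgorin X (fun _ _ ↦ (0 : ℝ)) ρ lam α hlam hXle hρsymm
  simp only [mul_zero, Finset.sum_const_zero, zero_add] at hgersh
  calc ∑ m ∈ T, F m ^ 2 * Pα m ^ 2
      ≤ ∑ m ∈ T, (cbar * Pα m ^ 2 + osc m * Pα m ^ 2) := Finset.sum_le_sum hterm
    _ = cbar * ∑ m ∈ T, Pα m ^ 2 + ∑ j, ∑ j', α j * α j' * X j j' := by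
        rw [Finset.sum_add_distrib, Finset.mul_sum, hoscsum]
    _ ≤ cbar * Q + ∑ j, α j ^ 2 * ∑ j', ρ j j' * lam j' / lam j :=
        add_le_add (mul_le_mul_of_nonneg_left hQ hcbar) hgersh

end Assembly

end Summit.RiemannHypothesis.RiemannHypothesis.Theorems.WeilFormatC

end
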